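import Literature.AlgebraicGeometry.HodgeTheory.DiagonalTorusUntwist
import Literature.AlgebraicGeometry.HodgeTheory.MonomialSupportedHypersurfaceMonodromy
import HarnessLib

/-!
# Every diagonal automorphism of a smooth hypersurface is a monodromy transformation

Family `hodge`, layer `Literature/AlgebraicGeometry/HodgeTheory`; theorems and concrete definitions only (no named
fact). Written by the prover seat `hodge-nonav-19716-p2` (g6) for crux K1-B `VeryGeneralSignCommutatorsInHg`
(stmt-HodgeConjecture-19716), third file after `DiagonalTorusFamily`, `DiagonalTorusUntwist`. THE TORUS TRICK,
conclusion: for a nonsingular form `F` of degree `d ≥ 1` in `n + 2 ≥ 3` variables and a diagonal symmetry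
`a ∈ diagonalStabilizer F`, the rational transport along the image LOOP `s ↦ [F(b_s • x)]` (`b_s = exp(s·log a)`) at
`[F] ∈ U(ℂ)` of the torus path is `(e⁻¹)^* ≫ g_a^* ≫ e^*` for the embedding-compatible identification `e : 𝒴_{[F]} ≅ X_F`
(`DiagonalTorusUntwist.transportFun_torusPath` pushed down by `isRatTransport_familySpz_iff` and the uniqueness of
compatible identifications):

* §3 `autPull` (`g_a^*` as a `ℚ`-linear automorphism), `IsDiagTransport`, `exists_loop_isRatTransport_autPull` and
  **`diagonalAut_conj_mem_ratMonodromyGroup`** — `e^* g_a^* (e^*)⁻¹ ∈ Γ_{[F]}`, the monodromy group of the universal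
  family of smooth degree-`d` hypersurfaces;
* §4 the same in the family of `M`-supported hypersurfaces when `F` is supported on `M`
  (**`diagonalAut_conj_mem_ratMonodromyGroup_familyM`**, via path lifting `exists_path_lift_toBase` and
  `conj_mem_ratMonodromyGroup_familyM`), together with the existence of compatible identifications
  (`exists_compatible_iso_familyM`).

Special cases in print: the covering transformation of a cyclic cover (Carlson–Toledo 1999 §2; tree
`CyclicCoverScaling.deck_mem_ratMonodromyGroup`), the `μ_d^{n+2}`-action on the Fermat hypersurface inside the Dwork
and monomial families (Katz 2009 §3: "the group acts as automorphisms of the family over its parameter space").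

## References

* [Katz2009] N. M. Katz, Another look at the Dwork family, Progr. Math. 269 (2009), §3.
* [CarlsonToledo1999] J. A. Carlson, D. Toledo, Discriminant complements and kernels of monodromy representations,
  Duke Math. J. 97 (1999), §2.
* [VoisinHodgeII2003] C. Voisin, Hodge Theory and Complex Algebraic Geometry II, CUP 2003, §3.1.2, §6.2.1.
* [CarlsonMullerStachPeters2017] J. Carlson, S. Müller-Stach, C. Peters, Period Mappings and Period Domains (2017),
  Lemma–Definition 15.3.7.
-/

noncomputable section

namespace Literature.AlgebraicGeometry.HodgeTheory

open CategoryTheory _root_.AlgebraicGeometry MvPolynomial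
open _root_.Topology
open Literature.AlgebraicGeometry.Motives Literature.AlgebraicGeometry.Motives.UniversalHypersurface
open Literature.AlgebraicGeometry.HodgeTheory.UniversalHypersurface
open Literature.AlgebraicTopology.SingularHomology
open Literature.NumberTheory.Transcendental
open scoped LinearAlgebra.Projectivization

namespace DiagonalTorus

/-! ### §3 The push-down to the universal family: `e^* g_a^* (e^*)⁻¹ ∈ Γ_{[F]}` -/

section Universal

variable {n d : ℕ} (F : MvPolynomial (Fin (n + 2)) ℂ) {a : Fin (n + 2) → ℂˣ}

/-- `g_{a⁻¹} ≫ g_a = 𝟙` over `ℂ`. [cite: Katz2009, §3] -/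
theorem diagonalAut_inv_comp_over (ha : a ∈ diagonalStabilizer F) :
    diagonalAut F (inv_mem ha) ≫ diagonalAut F ha = 𝟙 _ :=
  Over.OverMorphism.ext (by rw [Over.comp_left, Over.id_left]; exact diagonalAut_left_inv_comp F ha)

/-- `g_a ≫ g_{a⁻¹} = 𝟙` over `ℂ`. [cite: Katz2009, §3] -/
theorem diagonalAut_comp_inv_over (ha : a ∈ diagonalStabilizer F) :
    diagonalAut F ha ≫ diagonalAut F (inv_mem ha) = 𝟙 _ :=
  Over.OverMorphism.ext (by rw [Over.comp_left, Over.id_left]; exact diagonalAut_left_comp_inv F ha)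

/-- **`g_a^*` as a `ℚ`-linear automorphism of `Hᵏ(X_F(ℂ); ℚ)`** (inverse `g_{a⁻¹}^*`). [cite: Katz2009, §3] -/
def autPull (ha : a ∈ diagonalStabilizer F) (k : ℕ) :
    bettiCohomology (SmoothHypersurface.hypersurface F) k ≃ₗ[ℚ] bettiCohomology (SmoothHypersurface.hypersurface F) k :=
  LinearEquiv.ofLinear (BettiUniverse.pull (diagonalAut F ha) k) (BettiUniverse.pull (diagonalAut F (inv_mem ha)) k)
    (by rw [← BettiUniverse.pull_comp, diagonalAut_comp_inv_over, BettiUniverse.pull_id])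
    (by rw [← BettiUniverse.pull_comp, diagonalAut_inv_comp_over, BettiUniverse.pull_id])

/-- `autPull` acts by `g_a^*`. [cite: Katz2009, §3] -/
theorem autPull_apply (ha : a ∈ diagonalStabilizer F) (k : ℕ) (v : bettiCohomology (SmoothHypersurface.hypersurface F) k) :
    autPull F ha k v = BettiUniverse.pull (diagonalAut F ha) k v := rfl

/-- `pull` composed twice. [cite: VoisinHodgeII2003, §3.1.2] -/
theorem pull_pull {X Y Z : SchemeOver ℂ} (g : X ⟶ Y) (h : Y ⟶ Z) (k : ℕ) (x : bettiCohomology Z k) :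
    BettiUniverse.pull g k (BettiUniverse.pull h k x) = BettiUniverse.pull (g ≫ h) k x := by
  rw [BettiUniverse.pull_comp]; rfl

variable {F}
variable (hF : F.IsHomogeneous d) (hJ : SmoothHypersurface.IsNonsingularForm ℂ F)

/-- **The rational transport along the torus path is `(e₁⁻¹)^* ≫ g_a^* ≫ e₂^*`** in the torus family.
[cite: Katz2009, §3] [cite: VoisinHodgeII2003, §3.1.2] -/
theorem isRatTransport_torusPath (hn : 1 ≤ n) (hd : 1 ≤ d) (ha : a ∈ diagonalStabilizer F) (k : ℕ)
    (e₁ : fiberOver (torusFamily d F) (torusPoint hF hJ 1) ≅ SmoothHypersurface.hypersurface F)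
    (he₁ : e₁.hom ≫ SmoothHypersurface.hypersurfaceι F =
      fiberι (torusFamily d F) (torusPoint hF hJ 1) ≫ totalToProjectiveSpace d F)
    (e₂ : fiberOver (torusFamily d F) (torusPoint hF hJ a) ≅ SmoothHypersurface.hypersurface F)
    (he₂ : e₂.hom ≫ SmoothHypersurface.hypersurfaceι F =
      fiberι (torusFamily d F) (torusPoint hF hJ a) ≫ totalToProjectiveSpace d F) :
    IsRatTransport (torusFamily d F) k (torusFamily_locallyTrivial d F hn hd) ⟦torusPathUniv hF hJ a⟧
      (BettiUniverse.pullEquiv e₁ k ≪≫ₗ autPull F ha k ≪≫ₗ (BettiUniverse.pullEquiv e₂ k).symm) := by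
  intro v
  have hnat : ∀ {X Y : SchemeOver ℂ} (g : X ⟶ Y) (w : bettiCohomology Y k),
      ofRatClass _ k (BettiUniverse.pull g k w) = complexBetti.map g k (ofRatClass _ k w) := fun g w =>
    ofRatClass_map k (AlgPoints.mapContinuous (L := ℂ) g) w
  rw [LinearEquiv.trans_apply, LinearEquiv.trans_apply, BettiUniverse.pullEquiv_apply,
    BettiUniverse.pullEquiv_symm_apply, autPull_apply, hnat, hnat, hnat]
  have h0 : ofRatClass _ k v = complexBetti.map e₁.hom k (complexBetti.map e₁.inv k (ofRatClass _ k v)) :=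
    (e₁.complexBetti_map_hom_map_inv k _).symm
  conv_rhs => rw [h0]
  rw [transportFun_torusPath hF hJ hn hd ha k e₁ he₁ e₂ he₂]

variable (F) in
/-- **The characterising property of the torus monodromy between two points of the universal family**: conjugate
of `g_a^*` by embedding-compatible identifications of the two fibres with `X_F`. [cite: Katz2009, §3] -/
def IsDiagTransport (ha : a ∈ diagonalStabilizer F) (k : ℕ) (s₁ s₂ : ComplexPoints (base ℂ n d))
    (T : bettiCohomology (fiberOver (family ℂ n d) s₁) k ≃ₗ[ℚ] bettiCohomology (fiberOver (family ℂ n d) s₂) k) :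
    Prop :=
  ∃ (ê₁ : fiberOver (family ℂ n d) s₁ ≅ SmoothHypersurface.hypersurface F)
    (ê₂ : fiberOver (family ℂ n d) s₂ ≅ SmoothHypersurface.hypersurface F),
    ê₁.hom ≫ SmoothHypersurface.hypersurfaceι F = fiberι (family ℂ n d) s₁ ≫ UniversalHypersurface.toProjectiveSpace ℂ n d ∧
    ê₂.hom ≫ SmoothHypersurface.hypersurfaceι F = fiberι (family ℂ n d) s₂ ≫ UniversalHypersurface.toProjectiveSpace ℂ n d ∧
    ∀ x, T x = BettiUniverse.pull ê₂.hom k (autPull F ha k (BettiUniverse.pull ê₁.inv k x))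

/-- Transfer of a rational transport with the property along equalities of the two base points with a third.
[cite: VoisinHodgeII2003, §3.1.2] -/
theorem exists_loop_of_eq (ha : a ∈ diagonalStabilizer F) (k : ℕ)
    (hU : IsCohomologicallyLocallyTrivialOn (family ℂ n d) Set.univ)
    {s₁ s₂ s₀ : (Set.univ : Set (ComplexPoints (base ℂ n d)))} (h₁ : s₁ = s₀) (h₂ : s₂ = s₀) (γ : Path s₁ s₂)
    {T : bettiCohomology (fiberOver (family ℂ n d) s₁.1) k ≃ₗ[ℚ] bettiCohomology (fiberOver (family ℂ n d) s₂.1) k}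
    (hT : IsRatTransport (family ℂ n d) k hU ⟦γ⟧ T) (hP : IsDiagTransport F ha k s₁.1 s₂.1 T) :
    ∃ (γ₀ : Path s₀ s₀) (T₀ : bettiCohomology (fiberOver (family ℂ n d) s₀.1) k ≃ₗ[ℚ]
        bettiCohomology (fiberOver (family ℂ n d) s₀.1) k),
      (∀ u, (γ₀ u).1 = (γ u).1) ∧ IsRatTransport (family ℂ n d) k hU ⟦γ₀⟧ T₀ ∧ IsDiagTransport F ha k s₀.1 s₀.1 T₀ := by
  subst h₁; subst h₂
  exact ⟨γ, T, fun _ => rfl, hT, hP⟩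

/-- **Embedding-compatible identifications of a fibre with `X_F` are unique** (`X_F ↪ ℙⁿ⁺¹` is a monomorphism).
[cite: VoisinHodgeII2003, §6.2.1] -/
theorem compatible_iso_unique {s : ComplexPoints (base ℂ n d)}
    (e e' : fiberOver (family ℂ n d) s ≅ SmoothHypersurface.hypersurface F)
    (he : e.hom ≫ SmoothHypersurface.hypersurfaceι F = fiberι (family ℂ n d) s ≫ UniversalHypersurface.toProjectiveSpace ℂ n d)
    (he' : e'.hom ≫ SmoothHypersurface.hypersurfaceι F = fiberι (family ℂ n d) s ≫ UniversalHypersurface.toProjectiveSpace ℂ n d) :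
    e = e' := by
  haveI := SmoothHypersurface.isClosedImmersion_hypersurfaceι_left F
  haveI : Mono (SmoothHypersurface.hypersurfaceι F) := Over.mono_of_mono_left _
  exact Iso.ext ((cancel_mono (SmoothHypersurface.hypersurfaceι F)).mp (he.trans he'.symm))

/-- A transport with the property at a single base point is `e^* g_a^* (e^*)⁻¹` for THE compatible identification.
[cite: Katz2009, §3] -/
theorem IsDiagTransport.eq_conj (ha : a ∈ diagonalStabilizer F) (k : ℕ) {s : ComplexPoints (base ℂ n d)}
    {T : bettiCohomology (fiberOver (family ℂ n d) s) k ≃ₗ[ℚ] bettiCohomology (fiberOver (family ℂ n d) s) k}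
    (hT : IsDiagTransport F ha k s s T) (e : fiberOver (family ℂ n d) s ≅ SmoothHypersurface.hypersurface F)
    (he : e.hom ≫ SmoothHypersurface.hypersurfaceι F = fiberι (family ℂ n d) s ≫ UniversalHypersurface.toProjectiveSpace ℂ n d) :
    T = BettiUniverse.pullEquiv e k ≪≫ₗ autPull F ha k ≪≫ₗ (BettiUniverse.pullEquiv e k).symm := by
  obtain ⟨ê₁, ê₂, h₁, h₂, hx⟩ := hT
  have e1 : ê₁ = e := compatible_iso_unique ê₁ e h₁ he
  have e2 : ê₂ = e := compatible_iso_unique ê₂ e h₂ he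
  subst e1; subst e2
  refine LinearEquiv.ext fun x => ?_
  rw [hx, LinearEquiv.trans_apply, LinearEquiv.trans_apply, BettiUniverse.pullEquiv_apply, BettiUniverse.pullEquiv_symm_apply]

/-- The image of the torus path in `U(ℂ)`: `s ↦ [F(b_s • x)]`. [cite: Katz2009, §3] -/
def uPath (a : Fin (n + 2) → ℂˣ) :
    Path (⟨AlgPoints.map (toBaseSpz ℂ n d (torusSpz d F)) (torusPoint hF hJ 1), Set.mem_univ _⟩ :
        (Set.univ : Set (ComplexPoints (base ℂ n d))))
      ⟨AlgPoints.map (toBaseSpz ℂ n d (torusSpz d F)) (torusPoint hF hJ a), Set.mem_univ _⟩ :=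
  (torusPathUniv hF hJ a).map (f := fun x : (Set.univ : Set (ComplexPoints (torusBase d F))) =>
      (⟨AlgPoints.map (toBaseSpz ℂ n d (torusSpz d F)) x.1, Set.mem_univ _⟩ :
        (Set.univ : Set (ComplexPoints (base ℂ n d)))))
    (((AlgPoints.continuous_map _).comp continuous_subtype_val).subtype_mk _)

/-- The forms along the image path are the twisted forms `F(b_s • x)`. [cite: Katz2009, §3] -/
theorem pointForm_uPath (a : Fin (n + 2) → ℂˣ) (u : unitInterval) :
    pointForm ℂ n d (uPath hF hJ a u).1 = aeval (diagonalSubst (expPath a u)) F :=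
  pointFormSpz_torusPoint hF hJ (expPath a u)

/-- **The torus monodromy read in the universal family satisfies `IsDiagTransport`.** [cite: Katz2009, §3] -/
theorem isDiagTransport_universal (ha : a ∈ diagonalStabilizer F) (k : ℕ)
    (e₁ : fiberOver (torusFamily d F) (torusPoint hF hJ 1) ≅ SmoothHypersurface.hypersurface F)
    (he₁ : e₁.hom ≫ SmoothHypersurface.hypersurfaceι F =
      fiberι (torusFamily d F) (torusPoint hF hJ 1) ≫ totalToProjectiveSpace d F)
    (e₂ : fiberOver (torusFamily d F) (torusPoint hF hJ a) ≅ SmoothHypersurface.hypersurface F)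
    (he₂ : e₂.hom ≫ SmoothHypersurface.hypersurfaceι F =
      fiberι (torusFamily d F) (torusPoint hF hJ a) ≫ totalToProjectiveSpace d F) :
    IsDiagTransport F ha k (AlgPoints.map (toBaseSpz ℂ n d (torusSpz d F)) (torusPoint hF hJ 1))
      (AlgPoints.map (toBaseSpz ℂ n d (torusSpz d F)) (torusPoint hF hJ a))
      ((BettiUniverse.pullEquiv (CyclicCoverScaling.fibIso (torusSpz d F) (torusPoint hF hJ 1)) k).symm ≪≫ₗ
        (BettiUniverse.pullEquiv e₁ k ≪≫ₗ autPull F ha k ≪≫ₗ (BettiUniverse.pullEquiv e₂ k).symm) ≪≫ₗ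
        BettiUniverse.pullEquiv (CyclicCoverScaling.fibIso (torusSpz d F) (torusPoint hF hJ a)) k) := by
  set F₁ := CyclicCoverScaling.fibIso (torusSpz d F) (torusPoint hF hJ 1) with hF₁
  set F₂ := CyclicCoverScaling.fibIso (torusSpz d F) (torusPoint hF hJ a) with hF₂
  have hc : ∀ (b : Fin (n + 2) → ℂˣ) (e : fiberOver (torusFamily d F) (torusPoint hF hJ b) ≅ SmoothHypersurface.hypersurface F)
      (he : e.hom ≫ SmoothHypersurface.hypersurfaceι F = fiberι (torusFamily d F) (torusPoint hF hJ b) ≫ totalToProjectiveSpace d F),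
      ((CyclicCoverScaling.fibIso (torusSpz d F) (torusPoint hF hJ b)).symm ≪≫ e).hom ≫ SmoothHypersurface.hypersurfaceι F =
        fiberι (family ℂ n d) (AlgPoints.map (toBaseSpz ℂ n d (torusSpz d F)) (torusPoint hF hJ b)) ≫
          UniversalHypersurface.toProjectiveSpace ℂ n d := by
    intro b e he
    rw [Iso.trans_hom, Iso.symm_hom, Category.assoc, he, ← Category.assoc]
    have h := fiberOverFamilyPullbackIso_hom_fiberι (family ℂ n d) (toBaseSpz ℂ n d (torusSpz d F)) (torusPoint hF hJ b)
    rw [← Iso.eq_inv_comp] at h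
    rw [CyclicCoverScaling.fibIso]
    erw [h]
    rfl
  refine ⟨F₁.symm ≪≫ e₁, F₂.symm ≪≫ e₂, hc 1 e₁ he₁, hc a e₂ he₂, fun x => ?_⟩
  simp only [LinearEquiv.trans_apply, BettiUniverse.pullEquiv_apply, BettiUniverse.pullEquiv_symm_apply, autPull_apply,
    Iso.trans_hom, Iso.trans_inv, Iso.symm_hom, Iso.symm_inv, pull_pull, Category.assoc]

/-- **The torus loop of the universal family carries the monodromy `e^* ∘ g_a^* ∘ (e^*)⁻¹`.** For a nonsingular
form `F` of degree `d ≥ 1` in `n + 2 ≥ 3` variables, a diagonal symmetry `a ∈ diagonalStabilizer F`, a point `s` of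
`U(ℂ)` equal to `[F]` and the embedding-compatible identification `e : 𝒴_s ≅ X_F`, there is a loop `γ` at `s`, all
of whose forms are the twisted forms `F(b_u • x)` (`b_u = exp(u·log a)`), whose rational transport is
`(e⁻¹)^* ≫ g_a^* ≫ e^*`. [cite: Katz2009, §3] [cite: VoisinHodgeII2003, §3.1.2] -/
theorem exists_loop_isRatTransport_autPull (hn : 1 ≤ n) (hd : 1 ≤ d) (ha : a ∈ diagonalStabilizer F) (k : ℕ)
    (s : ComplexPoints (base ℂ n d)) (hs : s = pointOfForm ℂ n d hF hJ)
    (e : fiberOver (family ℂ n d) s ≅ SmoothHypersurface.hypersurface F)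
    (he : e.hom ≫ SmoothHypersurface.hypersurfaceι F = fiberι (family ℂ n d) s ≫ UniversalHypersurface.toProjectiveSpace ℂ n d) :
    ∃ γ : Path (⟨s, Set.mem_univ s⟩ : (Set.univ : Set (ComplexPoints (base ℂ n d)))) ⟨s, Set.mem_univ s⟩,
      (∀ u, pointForm ℂ n d (γ u).1 = aeval (diagonalSubst (expPath a u)) F) ∧
      IsRatTransport (family ℂ n d) k (isCohomologicallyLocallyTrivialOn_family n d hd) ⟦γ⟧
        (BettiUniverse.pullEquiv e k ≪≫ₗ autPull F ha k ≪≫ₗ (BettiUniverse.pullEquiv e k).symm) := by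
  have hU := isCohomologicallyLocallyTrivialOn_family n d hd
  -- in the torus family
  obtain ⟨e₁, he₁⟩ := exists_compatible_iso_torusPoint hF hJ hd 1 (aeval_diagonalSubst_one F)
  obtain ⟨e₂, he₂⟩ := exists_compatible_iso_torusPoint hF hJ hd a (twist_eq_of_mem ha)
  have hTL := isRatTransport_torusPath hF hJ hn hd ha k e₁ he₁ e₂ he₂
  -- in the universal family
  have hTU := (CyclicCoverScaling.isRatTransport_familySpz_iff (torusSpz d F) k hU
    (torusFamily_locallyTrivial d F hn hd) (torusPathUniv hF hJ a) (uPath hF hJ a) (fun _ => rfl) _).mp hTL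
  have hP := isDiagTransport_universal hF hJ ha k e₁ he₁ e₂ he₂
  -- move both end points to `s`
  have h₁ : (⟨AlgPoints.map (toBaseSpz ℂ n d (torusSpz d F)) (torusPoint hF hJ 1), Set.mem_univ _⟩ :
      (Set.univ : Set (ComplexPoints (base ℂ n d)))) = ⟨s, Set.mem_univ s⟩ :=
    Subtype.ext ((map_toBaseSpz_torusPoint_of_mem hF hJ (one_mem _)).trans hs.symm)
  have h₂ : (⟨AlgPoints.map (toBaseSpz ℂ n d (torusSpz d F)) (torusPoint hF hJ a), Set.mem_univ _⟩ :
      (Set.univ : Set (ComplexPoints (base ℂ n d)))) = ⟨s, Set.mem_univ s⟩ :=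
    Subtype.ext ((map_toBaseSpz_torusPoint_of_mem hF hJ ha).trans hs.symm)
  obtain ⟨γ₀, T₀, hγ₀, hT₀, hP₀⟩ := exists_loop_of_eq ha k hU h₁ h₂ (uPath hF hJ a) hTU hP
  refine ⟨γ₀, fun u => ?_, ?_⟩
  · rw [hγ₀]; exact pointForm_uPath hF hJ a u
  · rw [← hP₀.eq_conj ha k e he]; exact hT₀

/-- **Every diagonal automorphism of a smooth hypersurface is a monodromy transformation of the universal family**:
`e^* ∘ g_a^* ∘ (e^*)⁻¹ ∈ Γ_{[F]}` (and its inverse), `Γ` the monodromy group of `Rᵏ π_* ℚ` of the universal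
family of smooth degree-`d` hypersurfaces in `ℙⁿ⁺¹` (`n, d ≥ 1`) at `[F]`, for the embedding-compatible
`e : 𝒴_{[F]} ≅ X_F`. Cyclic covers: Carlson–Toledo §2 (tree `CyclicCoverScaling.deck_mem_ratMonodromyGroup`).
[cite: Katz2009, §3] [cite: CarlsonToledo1999, §2] -/
theorem diagonalAut_conj_mem_ratMonodromyGroup (hn : 1 ≤ n) (hd : 1 ≤ d) (ha : a ∈ diagonalStabilizer F) (k : ℕ)
    (e : fiberOver (family ℂ n d) (pointOfForm ℂ n d hF hJ) ≅ SmoothHypersurface.hypersurface F)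
    (he : e.hom ≫ SmoothHypersurface.hypersurfaceι F =
      fiberι (family ℂ n d) (pointOfForm ℂ n d hF hJ) ≫ UniversalHypersurface.toProjectiveSpace ℂ n d) :
    BettiUniverse.pullEquiv e k ≪≫ₗ autPull F ha k ≪≫ₗ (BettiUniverse.pullEquiv e k).symm ∈
      ratMonodromyGroup (family ℂ n d) k (isCohomologicallyLocallyTrivialOn_family n d hd)
        ⟨pointOfForm ℂ n d hF hJ, Set.mem_univ _⟩ := by
  obtain ⟨γ, -, hT⟩ := exists_loop_isRatTransport_autPull hF hJ hn hd ha k _ rfl e he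
  exact mem_ratMonodromyGroup_of_isRatTransport _ _ _ hT

end Universal

/-! ### §4 The same in the family of `M`-supported hypersurfaces -/

section SupportedFamily

variable {n d : ℕ} {F : MvPolynomial (Fin (n + 2)) ℂ} (M : Set (DegIndex n d))
  (hF : F.IsHomogeneous d) (hJ : SmoothHypersurface.IsNonsingularForm ℂ F)

/-- Twisting preserves the monomial support: `F(b • x)` is supported on `M` when `F` is. [cite: VoisinHodgeII2003, §6.2.1] -/
theorem isSupportedOn_twist (hM : IsSupportedOn n d M F) (b : Fin (n + 2) → ℂˣ) :
    IsSupportedOn n d M (aeval (diagonalSubst b) F) := fun m hm => by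
  rw [coeff_aeval_diagonalSubst, hM m hm, mul_zero]

/-- **An embedding-compatible identification `𝒴_{M,[F]} ≅ X_F` exists** for the `M`-supported family at the point
of an `M`-supported nonsingular form `F` (`d ≥ 1`). [cite: VoisinHodgeII2003, §6.2.1] -/
theorem exists_compatible_iso_familyM (hd : 1 ≤ d) (hM : IsSupportedOn n d M F) :
    ∃ e : fiberOver (familyM ℂ n d M) (pointOfFormM ℂ n d M hF hJ hM) ≅ SmoothHypersurface.hypersurface F,
      e.hom ≫ SmoothHypersurface.hypersurfaceι F = fiberToProjectiveSpace ℂ n d M (pointOfFormM ℂ n d M hF hJ hM) := by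
  obtain ⟨e₀, he₀⟩ := exists_fiberIsoM_comp_hypersurfaceι ℂ n d M (by omega) (pointOfFormM ℂ n d M hF hJ hM)
  have hG : pointFormM ℂ n d M (pointOfFormM ℂ n d M hF hJ hM) = F := pointFormM_pointOfFormM ℂ n d M hF hJ hM
  revert e₀ he₀
  generalize pointFormM ℂ n d M (pointOfFormM ℂ n d M hF hJ hM) = G at hG
  subst hG
  intro e₀ he₀
  exact ⟨e₀, he₀⟩

/-- **Every diagonal automorphism of a smooth `M`-supported hypersurface is a monodromy transformation of the
`M`-supported family**: `e^* ∘ g_a^* ∘ (e^*)⁻¹ ∈ Γ_{M,[F]}` for the embedding-compatible `e : 𝒴_{M,[F]} ≅ X_F`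
(the torus loop consists of `M`-supported forms, so it lifts to `S_M(ℂ)`, `exists_path_lift_toBase`, and the
universal monodromy restricts, `conj_mem_ratMonodromyGroup_familyM`). [cite: Katz2009, §3] [cite: VoisinHodgeII2003, §3.1.2] -/
theorem diagonalAut_conj_mem_ratMonodromyGroup_familyM (hn : 1 ≤ n) (hd : 1 ≤ d) (hM : IsSupportedOn n d M F)
    {a : Fin (n + 2) → ℂˣ} (ha : a ∈ diagonalStabilizer F) (k : ℕ)
    (hU' : IsCohomologicallyLocallyTrivialOn (familyM ℂ n d M) Set.univ)
    (e : fiberOver (familyM ℂ n d M) (pointOfFormM ℂ n d M hF hJ hM) ≅ SmoothHypersurface.hypersurface F)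
    (he : e.hom ≫ SmoothHypersurface.hypersurfaceι F = fiberToProjectiveSpace ℂ n d M (pointOfFormM ℂ n d M hF hJ hM)) :
    BettiUniverse.pullEquiv e k ≪≫ₗ autPull F ha k ≪≫ₗ (BettiUniverse.pullEquiv e k).symm ∈
      ratMonodromyGroup (familyM ℂ n d M) k hU' ⟨pointOfFormM ℂ n d M hF hJ hM, Set.mem_univ _⟩ := by
  have hU := isCohomologicallyLocallyTrivialOn_family n d hd
  have hpt : AlgPoints.map (toBase ℂ n d M) (pointOfFormM ℂ n d M hF hJ hM) = pointOfForm ℂ n d hF hJ :=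
    map_toBase_pointOfFormM ℂ n d M hF hJ hM
  generalize ht₀ : pointOfFormM ℂ n d M hF hJ hM = t₀ at e he hpt ⊢
  -- the compatible identification of the universal fibre over `g_M t₀`
  have hê : ((fiberIsoM ℂ n d M t₀).symm ≪≫ e).hom ≫ SmoothHypersurface.hypersurfaceι F =
      fiberι (family ℂ n d) (AlgPoints.map (toBase ℂ n d M) t₀) ≫ UniversalHypersurface.toProjectiveSpace ℂ n d := by
    rw [Iso.trans_hom, Iso.symm_hom, Category.assoc, he, Iso.inv_comp_eq, fiberIsoM_hom_toProjectiveSpace]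
  obtain ⟨γ, hγF, hT⟩ := exists_loop_isRatTransport_autPull hF hJ hn hd ha k _ hpt ((fiberIsoM ℂ n d M t₀).symm ≪≫ e) hê
  -- lift the loop to `S_M(ℂ)`
  obtain ⟨γ', hγ'⟩ := exists_path_lift_toBase ℂ n d M (t₁ := t₀) (t₂ := t₀) (γ.map continuous_subtype_val)
    (fun u => by
      change IsSupportedOn n d M (pointForm ℂ n d (γ u).1)
      rw [hγF u]; exact isSupportedOn_twist M hM _)
  have hmem := conj_mem_ratMonodromyGroup_familyM n d M k hU hU'
    (γ'.map (continuous_id.subtype_mk fun x => Set.mem_univ x)) γ (fun u => hγ' u) hT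
  -- identify the conjugate
  have heq : BettiUniverse.pullEquiv (fiberIsoM ℂ n d M t₀) k ≪≫ₗ
        (BettiUniverse.pullEquiv ((fiberIsoM ℂ n d M t₀).symm ≪≫ e) k ≪≫ₗ autPull F ha k ≪≫ₗ
          (BettiUniverse.pullEquiv ((fiberIsoM ℂ n d M t₀).symm ≪≫ e) k).symm) ≪≫ₗ
        (BettiUniverse.pullEquiv (fiberIsoM ℂ n d M t₀) k).symm =
      BettiUniverse.pullEquiv e k ≪≫ₗ autPull F ha k ≪≫ₗ (BettiUniverse.pullEquiv e k).symm := by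
    refine LinearEquiv.ext fun x => ?_
    simp only [LinearEquiv.trans_apply, BettiUniverse.pullEquiv_apply, BettiUniverse.pullEquiv_symm_apply,
      Iso.trans_hom, Iso.trans_inv, Iso.symm_hom, Iso.symm_inv, pull_pull, Category.assoc, Iso.hom_inv_id,
      Category.comp_id, Iso.hom_inv_id_assoc]
  rw [← heq]
  exact hmem

end SupportedFamily

end DiagonalTorus

end Literature.AlgebraicGeometry.HodgeTheory

end
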